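import Literature.Analysis.FluidPDE.AncientLimitVanishing
import Literature.Analysis.FluidPDE.ESSLocalHolderBlowupLimit
import Literature.Analysis.FluidPDE.LocalTypeIScaling
import Literature.Analysis.FluidPDE.CKNScalingExtras
import Literature.Analysis.FluidPDE.HarmonicLiouvilleLp
import Literature.Analysis.FluidPDE.ChaeAsymptoticallySelfSimilarWeakLimit
import HarnessLib

/-!
# Vanishing of a local energy ancient solution with a bounded far field
# (the endgame of ESS 2003, §5 / Wang–Zhang 2017, §4 Step 3, with far-field bound `L`)

Analysis/FluidPDE proofs-only file (theorems only: no definition, no named fact; nothing accepted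
is restated or changed). The tree's `ancient_lintegral_cube_half_eq_zero_of_farField_of_top_of_liouville`
(`AncientLimitVanishing.lean`) concludes `∫_{Q(1/2)} |w|³ = 0` for a local energy ancient solution
`(w, π)` that vanishes weakly at the top, whose slices satisfy a Liouville property, and which is
bounded by `1` on `]-2, 0[ × {|x| > R₀}` — the normalisation "`|v| ≤ 1`" that ESS 2003 (proof of
Thm. 5.1) and Wang–Zhang 2017 (§4 Step 3) reach after rescaling. This file performs that
rescaling: if instead `|w| ≤ L` on `]-T₁, 0[ × {|x| > R₀}` (`T₁ ≥ 2`), the Navier–Stokes rescaling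
`w_λ(s, y) = λ w(λ² s, λ y)`, `π_λ = λ² π(λ² s, λ y)` with `λ = min(1, 1/L)` is bounded by `1` far out,
inherits all the other hypotheses (scale covariance of Albritton–Barker's class
`IsSuitableWeakSolutionInBall.zoomOut`, of `D` `cknD_nsZoom`, of the weak vanishing at the top by
the change of variables `y = λ⁻¹ x`, and of the Liouville property since dilations of harmonic
functions are harmonic), so `∫_{Q(1/2)} |w_λ|³ = 0`, i.e. `∫_{Q(λ/2)} |w|³ = 0`
(`ancient_lintegral_cube_eq_zero_of_farField_le`).

## References

* L. Escauriaza, G. Seregin, V. Šverák, Russ. Math. Surveys 58 (2003), Thm. 5.1 and its proof.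
  [EscauriazaSereginSverak2003]
* W. Wang, Z. Zhang, Sci. China Math. 60 (2017) = arXiv:1510.02589, §4 Step 3. [WangZhang2016]
-/

noncomputable section

open MeasureTheory Set Function Filter Topology TopologicalSpace Metric InnerProductSpace
open scoped NNReal ENNReal RealInnerProductSpace Laplacian

namespace Literature.Analysis.FluidPDE

/-! ### Dilations of harmonic functions -/

section Harmonic

/-- **Dilations of entire harmonic functions are harmonic**: if `V` is harmonic on `ℝ³` then so
is `x ↦ c • V(a • x)` (`Δ(V ∘ (a •)) = a² (ΔV) ∘ (a •)` by the chain rule for the second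
derivative along an orthonormal basis). [folklore] -/
theorem harmonicOnNhd_smul_comp_smul {V : EuclideanSpace ℝ (Fin 3) → EuclideanSpace ℝ (Fin 3)}
    (hV : HarmonicOnNhd V (univ : Set (EuclideanSpace ℝ (Fin 3)))) (c a : ℝ) :
    HarmonicOnNhd (fun x => c • V (a • x)) (univ : Set (EuclideanSpace ℝ (Fin 3))) := by
  have hcd : ContDiff ℝ 2 V := contDiffOn_univ.1 hV.contDiffOn
  have hΔ : ∀ y, Δ V y = 0 := fun y => by
    have h := (hV y (mem_univ y)).2.eq_of_nhds
    simpa using h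
  -- the dilation as composition with a continuous linear map
  set La : EuclideanSpace ℝ (Fin 3) →L[ℝ] EuclideanSpace ℝ (Fin 3) :=
    a • ContinuousLinearMap.id ℝ (EuclideanSpace ℝ (Fin 3)) with hL
  have hLx : ∀ x, La x = a • x := fun x => by rw [hL]; simp
  have hcomp : (fun x => V (a • x)) = V ∘ La := by funext x; rw [Function.comp_apply, hLx]
  have hcd' : ContDiff ℝ 2 fun x => V (a • x) := by rw [hcomp]; exact hcd.comp La.contDiff
  have hΔ' : ∀ x, Δ (fun x => V (a • x)) x = 0 := by
    intro x
    rw [laplacian_eq_iteratedFDeriv_orthonormalBasis _ (EuclideanSpace.basisFun (Fin 3) ℝ), hcomp]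
    dsimp only
    have e : ∀ i : Fin 3, iteratedFDeriv ℝ 2 (V ∘ La) x
        ![EuclideanSpace.basisFun (Fin 3) ℝ i, EuclideanSpace.basisFun (Fin 3) ℝ i] =
        (a * a) • iteratedFDeriv ℝ 2 V (La x)
          ![EuclideanSpace.basisFun (Fin 3) ℝ i, EuclideanSpace.basisFun (Fin 3) ℝ i] := by
      intro i
      rw [La.iteratedFDeriv_comp_right hcd x le_rfl, ContinuousMultilinearMap.compContinuousLinearMap_apply]
      have h1 : (fun j : Fin 2 => La (![EuclideanSpace.basisFun (Fin 3) ℝ i,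
          EuclideanSpace.basisFun (Fin 3) ℝ i] j)) =
          fun j => (fun _ : Fin 2 => a) j • ![EuclideanSpace.basisFun (Fin 3) ℝ i,
            EuclideanSpace.basisFun (Fin 3) ℝ i] j := by
        funext j; rw [hLx]
      rw [h1, ContinuousMultilinearMap.map_smul_univ]
      simp only [Finset.prod_const, Finset.card_univ, Fintype.card_fin]
      rw [sq]
    simp_rw [e, ← Finset.smul_sum]
    have h2 : ∑ i : Fin 3, iteratedFDeriv ℝ 2 V (La x)
        ![EuclideanSpace.basisFun (Fin 3) ℝ i, EuclideanSpace.basisFun (Fin 3) ℝ i] = Δ V (La x) := by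
      rw [laplacian_eq_iteratedFDeriv_orthonormalBasis _ (EuclideanSpace.basisFun (Fin 3) ℝ)]
    rw [h2, hΔ, smul_zero]
  exact (harmonicOnNhd_of_laplacian_eq_zero hcd' hΔ').const_smul

end Harmonic

/-! ### A.e. statements under affine changes of the time variable and under spatial dilations -/

section AE

/-- **A.e. statements on `ℝ` transport under affine maps** `s ↦ d + c s`, `c ≠ 0`. [folklore] -/
theorem ae_restrict_comp_affine' {P : ℝ → Prop} {S : Set ℝ} (hS : MeasurableSet S)
    (h : ∀ᵐ t ∂(volume.restrict S), P t) {c d : ℝ} (hc : c ≠ 0) {S' : Set ℝ}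
    (hS' : MeasurableSet S') (hmap : ∀ s ∈ S', d + c * s ∈ S) :
    ∀ᵐ s ∂(volume.restrict S'), P (d + c * s) := by
  rw [ae_restrict_iff' hS] at h
  rw [ae_restrict_iff' hS']
  have hq : Measure.QuasiMeasurePreserving (fun s : ℝ => d + c * s) volume volume := by
    have h1 : Measure.QuasiMeasurePreserving (fun s : ℝ => c * s) volume volume := by
      refine ⟨measurable_const_mul c, ?_⟩
      rw [Real.map_volume_mul_left hc]
      exact Measure.smul_absolutelyContinuous
    exact (measurePreserving_add_left volume d).quasiMeasurePreserving.comp h1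
  filter_upwards [hq.ae h] with s hs hsS'
  exact hs (hmap s hsS')

/-- **The parabolic dilation `(s, y) ↦ (λ² s, λ y)` is quasi measure preserving** on `ℝ × ℝ³`.
[folklore] -/
theorem quasiMeasurePreserving_parabolicDilation {lam : ℝ} (hlam : lam ≠ 0) :
    Measure.QuasiMeasurePreserving
      (fun z : ℝ × EuclideanSpace ℝ (Fin 3) => (lam ^ 2 * z.1, lam • z.2)) volume volume := by
  have h1 : Measure.QuasiMeasurePreserving (fun s : ℝ => lam ^ 2 * s) volume volume := by
    refine ⟨measurable_const_mul _, ?_⟩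
    rw [Real.map_volume_mul_left (pow_ne_zero 2 hlam)]
    exact Measure.smul_absolutelyContinuous
  have h2 : Measure.QuasiMeasurePreserving (fun x : EuclideanSpace ℝ (Fin 3) => lam • x) volume
      volume := Measure.quasiMeasurePreserving_smul volume hlam
  have h := MeasureTheory.QuasiMeasurePreserving.prodMap h1 h2
  rw [Measure.volume_eq_prod]
  exact h

end AE

/-! ### The rescaled endgame -/

section Scaled

variable {w : ℝ → EuclideanSpace ℝ (Fin 3) → EuclideanSpace ℝ (Fin 3)}
  {π : ℝ → EuclideanSpace ℝ (Fin 3) → ℝ}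

set_option maxHeartbeats 1600000 in
/-- **The local energy ancient solution vanishes near the origin — far-field bound `L`.** Let
`(w, π)` be a suitable weak solution in every `Q(a)` whose pressure satisfies `D(r; z₀) ≤ P` at all
apices `t₀ ≤ 0` and radii `r ≤ 1`, which vanishes weakly at `t = 0` (`htop`), which is bounded by
`L` a.e. on `]-T₁, 0[ × {|x| > R₀}` (`T₁ ≥ 2`), and whose slices have the Liouville property for
a.e. `t ∈ ]-1, 0[`. Then `∫_{Q(λ/2)} |w|³ = 0` for `λ = min(1, 1/L)`: apply
`ancient_lintegral_cube_half_eq_zero_of_farField_of_top_of_liouville` to the rescaled pair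
`(λ w(λ²·, λ·), λ² π(λ²·, λ·))`, which is bounded by `λ L ≤ 1` far out. (ESS 2003, proof of
Thm. 5.1: "we may assume `|v| ≤ 1`"; Wang–Zhang 2017, §4 Step 3.) [cite: EscauriazaSereginSverak2003, Thm. 5.1] [cite: WangZhang2016, §4 Step 3] -/
theorem ancient_lintegral_cube_eq_zero_of_farField_le
    (hw : ∀ a : ℝ, 0 < a →
      IsSuitableWeakSolutionInBall a (0 : ℝ × EuclideanSpace ℝ (Fin 3)) w π)
    {P : ℝ≥0} (hP : ∀ z₀ : ℝ × EuclideanSpace ℝ (Fin 3), z₀.1 ≤ 0 → ∀ r ∈ Ioc (0 : ℝ) 1,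
      cknD r z₀ π ≤ P)
    (htop : ∀ φ : EuclideanSpace ℝ (Fin 3) → EuclideanSpace ℝ (Fin 3), ContDiff ℝ (⊤ : ℕ∞) φ →
      HasCompactSupport φ → ∀ ε : ℝ, 0 < ε →
        ∃ s₀ : ℝ, s₀ < 0 ∧ ∀ᵐ s ∂(volume.restrict (Ioo s₀ 0)), |∫ y, ⟪w s y, φ y⟫| ≤ ε)
    {L R₀ T₁ : ℝ} (hL : 0 < L) (hR₀ : 0 < R₀) (hT₁ : 2 ≤ T₁)
    (hfar : ∀ᵐ z ∂(volume.restrict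
      (Ioo (-T₁) 0 ×ˢ (closedBall (0 : EuclideanSpace ℝ (Fin 3)) R₀)ᶜ)), ‖w z.1 z.2‖ ≤ L)
    (hL' : ∀ᵐ t ∂(volume.restrict (Ioo (-1 : ℝ) 0)),
      ∀ V : EuclideanSpace ℝ (Fin 3) → EuclideanSpace ℝ (Fin 3),
        HarmonicOnNhd V (univ : Set (EuclideanSpace ℝ (Fin 3))) → V =ᵐ[volume] w t → V = 0) :
    ∫⁻ z in parabolicCylinder (min 1 L⁻¹ / 2) (0 : ℝ × EuclideanSpace ℝ (Fin 3)),
      ‖w z.1 z.2‖ₑ ^ (3 : ℕ) = 0 := by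
  -- ### the scale
  set lam : ℝ := min 1 L⁻¹ with hlamdef
  have hlampos : 0 < lam := lt_min one_pos (inv_pos.2 hL)
  have hlam1 : lam ≤ 1 := min_le_left _ _
  have hlamL : lam * L ≤ 1 := by
    calc lam * L ≤ L⁻¹ * L := mul_le_mul_of_nonneg_right (min_le_right _ _) hL.le
      _ = 1 := inv_mul_cancel₀ hL.ne'
  have hlam0 : lam ≠ 0 := hlampos.ne'
  have hlam2 : 0 < lam ^ 2 := pow_pos hlampos 2
  -- ### the rescaled pair
  set w' : ℝ → EuclideanSpace ℝ (Fin 3) → EuclideanSpace ℝ (Fin 3) :=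
    lam • stPull (lam ^ 2) lam (0 : ℝ) (0 : EuclideanSpace ℝ (Fin 3)) w with hw'def
  set π' : ℝ → EuclideanSpace ℝ (Fin 3) → ℝ :=
    lam ^ 2 • stPull (lam ^ 2) lam (0 : ℝ) (0 : EuclideanSpace ℝ (Fin 3)) π with hπ'def
  have hw'apply : ∀ s y, w' s y = lam • w (lam ^ 2 * s) (lam • y) := fun s y => by
    rw [hw'def]; simp only [Pi.smul_apply, stPull_apply, zero_add]
  have hst0 : ∀ z : ℝ × EuclideanSpace ℝ (Fin 3),
      stAffine (lam ^ 2) lam (0 : ℝ) (0 : EuclideanSpace ℝ (Fin 3)) z = (lam ^ 2 * z.1, lam • z.2) := by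
    intro z
    rw [show z = (z.1, z.2) from rfl, stAffine_apply, zero_add, zero_add]
  -- (i) suitable in every `Q(a)`
  have hw'suit : ∀ a : ℝ, 0 < a →
      IsSuitableWeakSolutionInBall a (0 : ℝ × EuclideanSpace ℝ (Fin 3)) w' π' := by
    intro a ha
    have h := (hw (a * lam) (mul_pos ha hlampos)).zoomOut hlampos
    rwa [mul_div_cancel_right₀ a hlam0] at h
  -- (ii) the pressure bounds at radius `1`
  have hP' : ∀ z₀ : ℝ × EuclideanSpace ℝ (Fin 3), z₀.1 ≤ 0 →
      ∫⁻ q in parabolicCylinder 1 z₀, ‖π' q.1 q.2‖ₑ ^ (3 / 2 : ℝ) ≤ P := by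
    intro z₀ hz₀
    have h1 : cknD 1 z₀ π' = cknD lam (stAffine (lam ^ 2) lam 0 0 z₀) π := by
      rw [hπ'def, cknD_nsZoom hlampos one_pos 0 0 z₀ π, mul_one]
    have h2 : cknD lam (stAffine (lam ^ 2) lam 0 0 z₀) π ≤ P := by
      refine hP _ ?_ lam ⟨hlampos, hlam1⟩
      rw [hst0]
      exact mul_nonpos_of_nonneg_of_nonpos hlam2.le hz₀
    have h3 : cknD 1 z₀ π' = ∫⁻ q in parabolicCylinder 1 z₀, ‖π' q.1 q.2‖ₑ ^ (3 / 2 : ℝ) := by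
      rw [cknD, ENNReal.ofReal_one, one_pow, inv_one, one_mul]
    rw [← h3, h1]
    exact h2
  -- (iii) weak vanishing at the top
  have htop' : ∀ φ : EuclideanSpace ℝ (Fin 3) → EuclideanSpace ℝ (Fin 3), ContDiff ℝ (⊤ : ℕ∞) φ →
      HasCompactSupport φ → ∀ ε : ℝ, 0 < ε →
        ∃ s₀ : ℝ, s₀ < 0 ∧ ∀ᵐ s ∂(volume.restrict (Ioo s₀ 0)), |∫ y, ⟪w' s y, φ y⟫| ≤ ε := by
    intro φ hφ hφc ε hε
    -- the dilated test function
    set φl : EuclideanSpace ℝ (Fin 3) → EuclideanSpace ℝ (Fin 3) := fun x => φ (lam⁻¹ • x) with hφl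
    have hφl_smooth : ContDiff ℝ (⊤ : ℕ∞) φl := hφ.comp (contDiff_const_smul _)
    have hφl_supp : HasCompactSupport φl := hφc.comp_smul (inv_ne_zero hlam0)
    obtain ⟨s₀, hs₀, hs₀ae⟩ := htop φl hφl_smooth hφl_supp (lam ^ 2 * ε) (by positivity)
    refine ⟨s₀ / lam ^ 2, div_neg_of_neg_of_pos hs₀ hlam2, ?_⟩
    -- the pairing of `w' s` with `φ` is `λ⁻²` times the pairing of `w (λ² s)` with `φl`
    have hpair : ∀ s, ∫ y, ⟪w' s y, φ y⟫ = (lam ^ 2)⁻¹ * ∫ x, ⟪w (lam ^ 2 * s) x, φl x⟫ := by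
      intro s
      have e1 : (fun y => ⟪w' s y, φ y⟫) = fun y =>
          lam * (fun x => ⟪w (lam ^ 2 * s) x, φl x⟫) (lam • y) := by
        funext y
        rw [hw'apply, real_inner_smul_left, hφl]
        dsimp only
        rw [smul_smul, inv_mul_cancel₀ hlam0, one_smul]
      rw [e1, integral_const_mul, Measure.integral_comp_smul_of_nonneg volume
        (fun x => ⟪w (lam ^ 2 * s) x, φl x⟫) lam (hR := hlampos.le), finrank_euclideanSpace_fin,
        smul_eq_mul, ← mul_assoc]
      congr 1
      field_simp
    have h1 := ae_restrict_comp_affine' measurableSet_Ioo hs₀ae (c := lam ^ 2) (d := 0) hlam2.ne'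
      (S' := Ioo (s₀ / lam ^ 2) 0) measurableSet_Ioo (fun s hs => by
        rw [zero_add]
        refine ⟨?_, mul_neg_of_pos_of_neg hlam2 hs.2⟩
        have := hs.1
        rw [div_lt_iff₀ hlam2] at this
        linarith)
    filter_upwards [h1] with s hs
    rw [zero_add] at hs
    rw [hpair, abs_mul, abs_inv, abs_of_pos hlam2]
    calc (lam ^ 2)⁻¹ * |∫ x, ⟪w (lam ^ 2 * s) x, φl x⟫| ≤ (lam ^ 2)⁻¹ * (lam ^ 2 * ε) :=
          mul_le_mul_of_nonneg_left hs (inv_nonneg.2 hlam2.le)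
      _ = ε := by field_simp
  -- (iv) the far-field bound `1`
  have hR₀' : 0 < R₀ / lam := div_pos hR₀ hlampos
  have hfar' : ∀ᵐ z ∂(volume.restrict
      (Ioo (-2 : ℝ) 0 ×ˢ (closedBall (0 : EuclideanSpace ℝ (Fin 3)) (R₀ / lam))ᶜ)), ‖w' z.1 z.2‖ ≤ 1 := by
    have hSm : MeasurableSet (Ioo (-T₁) (0 : ℝ) ×ˢ (closedBall (0 : EuclideanSpace ℝ (Fin 3)) R₀)ᶜ) :=
      measurableSet_Ioo.prod measurableSet_closedBall.compl
    have hS'm : MeasurableSet (Ioo (-2 : ℝ) 0 ×ˢ (closedBall (0 : EuclideanSpace ℝ (Fin 3)) (R₀ / lam))ᶜ) :=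
      measurableSet_Ioo.prod measurableSet_closedBall.compl
    rw [ae_restrict_iff' hSm] at hfar
    rw [ae_restrict_iff' hS'm]
    filter_upwards [(quasiMeasurePreserving_parabolicDilation hlam0).ae hfar] with z hz hzS'
    rw [mem_prod, mem_Ioo, mem_compl_iff, mem_closedBall, dist_zero_right, not_le] at hzS'
    have hmem : ((lam ^ 2 * z.1, lam • z.2) : ℝ × EuclideanSpace ℝ (Fin 3)) ∈
        Ioo (-T₁) (0 : ℝ) ×ˢ (closedBall (0 : EuclideanSpace ℝ (Fin 3)) R₀)ᶜ := by
      refine ⟨⟨?_, mul_neg_of_pos_of_neg hlam2 hzS'.1.2⟩, ?_⟩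
      · have h1 : lam ^ 2 ≤ 1 := pow_le_one₀ hlampos.le hlam1
        nlinarith [hzS'.1.1]
      · rw [mem_compl_iff, mem_closedBall, dist_zero_right, not_le, norm_smul, Real.norm_eq_abs,
          abs_of_pos hlampos]
        have := hzS'.2
        rw [div_lt_iff₀ hlampos] at this
        linarith
    have hb := hz hmem
    rw [hw'apply, norm_smul, Real.norm_eq_abs, abs_of_pos hlampos]
    calc lam * ‖w (lam ^ 2 * z.1) (lam • z.2)‖ ≤ lam * L := mul_le_mul_of_nonneg_left hb hlampos.le
      _ ≤ 1 := hlamL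
  -- (v) the Liouville property of the rescaled slices
  have hL'' : ∀ᵐ t ∂(volume.restrict (Ioo (-1 : ℝ) 0)),
      ∀ V : EuclideanSpace ℝ (Fin 3) → EuclideanSpace ℝ (Fin 3),
        HarmonicOnNhd V (univ : Set (EuclideanSpace ℝ (Fin 3))) → V =ᵐ[volume] w' t → V = 0 := by
    have h1 := ae_restrict_comp_affine' measurableSet_Ioo hL' (c := lam ^ 2) (d := 0) hlam2.ne'
      (S' := Ioo (-1 : ℝ) 0) measurableSet_Ioo (fun t ht => by
        rw [zero_add]
        refine ⟨?_, mul_neg_of_pos_of_neg hlam2 ht.2⟩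
        have h1 : lam ^ 2 ≤ 1 := pow_le_one₀ hlampos.le hlam1
        nlinarith [ht.1])
    filter_upwards [h1] with t ht V hV hVw
    rw [zero_add] at ht
    -- the un-dilated harmonic function
    set V₀ : EuclideanSpace ℝ (Fin 3) → EuclideanSpace ℝ (Fin 3) := fun x => lam⁻¹ • V (lam⁻¹ • x) with hV₀
    have hV₀h : HarmonicOnNhd V₀ (univ : Set (EuclideanSpace ℝ (Fin 3))) :=
      harmonicOnNhd_smul_comp_smul hV lam⁻¹ lam⁻¹
    have hV₀w : V₀ =ᵐ[volume] w (lam ^ 2 * t) := by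
      have h2 := (Measure.quasiMeasurePreserving_smul volume (inv_ne_zero hlam0)).ae hVw
      filter_upwards [h2] with x hx
      rw [hV₀]
      dsimp only
      rw [hx, hw'apply, smul_smul, smul_smul, inv_mul_cancel₀ hlam0, one_smul, mul_inv_cancel₀ hlam0,
        one_smul]
    have h0 := ht V₀ hV₀h hV₀w
    funext y
    have h3 : V₀ (lam • y) = 0 := by rw [h0]; rfl
    rw [hV₀] at h3
    dsimp only at h3
    rw [smul_smul, inv_mul_cancel₀ hlam0, one_smul] at h3
    have h4 : V y = lam • (lam⁻¹ • V y) := by rw [smul_smul, mul_inv_cancel₀ hlam0, one_smul]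
    rw [h4, h3, smul_zero]
    rfl
  -- (vi) the endgame for the rescaled pair, and back
  have hzero := ancient_lintegral_cube_half_eq_zero_of_farField_of_top_of_liouville hw'suit hP' htop'
    hR₀' hfar' hL''
  have h1 : cknC (1 / 2) 0 w' = 0 := by
    rw [cknC, hzero, mul_zero]
  have h2 : cknC (1 / 2) 0 w' = cknC (lam / 2) 0 w := by
    rw [hw'def, cknC_nsZoom hlampos (by norm_num : (0 : ℝ) < 1 / 2) 0 0 0 w, hst0]
    simp only [Prod.fst_zero, Prod.snd_zero, mul_zero, smul_zero]
    rw [show lam * (1 / 2) = lam / 2 by ring]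
    rfl
  rw [h2, cknC] at h1
  have hne : (ENNReal.ofReal (lam / 2) ^ 2)⁻¹ ≠ 0 :=
    ENNReal.inv_ne_zero.2 (ENNReal.pow_ne_top ENNReal.ofReal_ne_top)
  rw [show min 1 L⁻¹ / 2 = lam / 2 by rw [hlamdef]]
  exact (mul_eq_zero.1 h1).resolve_left hne

end Scaled



end Literature.Analysis.FluidPDE

end
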